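import Literature.MathematicalPhysics.QuantumFieldTheory.Balaban1983to89.B9Thm314GpFlatMultiLevelTorus
import Literature.MathematicalPhysics.QuantumFieldTheory.Balaban1983to89.B6Prop22AdjMultiLevelTorus
import Literature.MathematicalPhysics.QuantumFieldTheory.Balaban1983to89.B6Prop22LapMultiLevelTorus

/-!
# `Balaban1983to89.B9Thm314GpFlatEntries` — [B9] THEOREM 3.14 (pp. 426–427, (3.154)) AT `U = 1` ON THE GENUINE
`k`-LEVEL TORUS: THE REMAINING SUP ENTRIES [4] (2.67)₂,₃,₆ (= [B9] (3.42)₂, the p. 398 remark, (3.42)₃) OF `G′ = Δ′_a⁻¹` — for two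
nested families `{Ω_j}`, `{Ω′_j}` on one torus, `Ω = Ω_k ∩ Ω′_k`, top blocks `y ∋ x`, `y′ ⊃ supp λ`:
`|(∇_μ(G′[Ω] − G′[Ω′])λ)(x)|, |((G′[Ω] − G′[Ω′])∇_μ*λ)(x)| ≤ C·L^k·e^{−δ·min(d_Ω,d_Ω′)(y,y′)}·e^{−δ·d(y,y′,Ω)}·|λ|` and
`|(Δ(G′[Ω] − G′[Ω′])λ)(x)| ≤ C·e^{−δ·min(d_Ω,d_Ω′)(y,y′)}·e^{−δ·d(y,y′,Ω)}·|λ|`, as instances of the master theorem of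
file 3 (no existing module is touched; no fact is minted)

FRAMING (verbatim cell line):
statement-level skeleton of published theorems with citation tags; proofs where landed; nothing here is a claim about the Yang–Mills mass gap

Sources under audit (cell pub-balaban / lit-balaban): T. Bałaban, *Propagators for lattice gauge theories in a
background field*, Commun. Math. Phys. **99** (1985) 389–434 [`Balaban1985BackgroundPropagators`, "B9"], pp. 426–427
[PDF 38–39] (Theorem 3.14, (3.154); held text `paper:balaban1985-cmp99-background-propagators` p0038/p0039), p. 397
(3.42); T. Bałaban, *Propagators and renormalization transformations for lattice gauge theories. II*, Commun. Math.
Phys. **96** (1984) 223–250 [`Balaban1984PropagatorsII`, "[4]"], Prop. 2.2 (2.67) p. 234.  Unit `lit-balaban-p21`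
(Phase-2 proof seat p21 gen 18, HOME `run/shared/lean/pub/lit-balaban/`, free-target protocol G.5-34(d); B9 fold owner
r06, B6 fold owner r03, referee ref-4).

## WHAT IS PRINTED

B9 Theorem 3.14 (p. 427): «If we take a pair of operators constructed for the two sequences {Ω_j}, {Ω′_j}, then their
difference satisfies all the inequalities characteristic for operators of the considered type, with the additional factor
exp(−δ₀d(y, y′, Ω)) … (3.154) on the right-hand sides.»  The characteristic sup inequalities of `G′`: [B9] (3.42) p. 397
lists THREE, «|(G′(U)λ)(x)|, |(∇_UG′(U)λ)(x)|, |(Δ_UG′(U)λ)(x)| ≤ B₀{(Lʲη)², Lʲη, 1}e^{−δ₀d(y,y′)}|λ| for x ∈ Δ(y), y ∈ Λ_j,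
supp λ ⊂ Δ(y′)», and p. 398 adds «the choice of derivatives ∇_U, ∇*_U is conventional, we may always replace ∇_U by ∇*_U,
and vice versa, in arbitrary place and combination» (so `G′∇*` is covered); [4] (2.67) p. 234 lists the sup members
`G′λ`, `∇G′λ`, `G′∇*λ`, `ΔG′λ` (its entries 1, 2, 3, 6) with the weights `(Lʲη)², Lʲη, Lʲη, 1` (the Hölder and `L²`
members are not treated here).

## WHAT THIS FILE CERTIFIES (kernel-checked; lattice units; setting of files 1–3 `B9Thm314GpFlat…`)

Three instances of `B9Thm314GpFlatMultiLevelTorus.thm314_flat_master` (the resolvent route of files 1–3, generic in the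
outer factors `A_L`, `A_R`), fed with the torus Prop. 2.2 entries BY NAME — constants `δ, C, M₀, N₀` `k`-uniform,
uniform in the direction `μ`, independent of the two families; hypotheses as in file 3's `thm314_Gp_flat_multiLevelTorus`
(top blocks `y, y′` common to both families, `supp λ ⊂ B^k(y′)`, `|λ| ≤ B`, `x ∈ B^k(y)`):
* **`thm314_dGp_flat_multiLevelTorus`** — `|((∇_μG′[D] − ∇_μG′[D′])λ)(x)| ≤ C·L^k·e^{−δ·min(d_D,d_{D′})(y,y′)}·e^{−δ·d(y,y′,Ω)}·B`
  (`A_L = ∇_μ = dT`, `A_R = 1`; packages `B6Prop22DerivMultiLevelTorus.prop22_second_multiLevelTorus` (composite and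
  left factor) and `B6Prop22MultiLevelTorus.prop22_first_multiLevelTorus` (inner factor)).
* **`thm314_Gpd_flat_multiLevelTorus`** — `|((G′[D]∇_μ* − G′[D′]∇_μ*)λ)(x)| ≤ C·L^k·(same factors)·B` (`A_L = 1`,
  `A_R = ∇_μ* = dTᵀ`; packages `B6Prop22AdjMultiLevelTorus.prop22_third_multiLevelTorus` (composite and inner factor,
  inner weight exponent `1`) and `prop22_first_multiLevelTorus` (left factor)).
* **`thm314_lapGp_flat_multiLevelTorus`** — `|((ΔG′[D] − ΔG′[D′])λ)(x)| ≤ C·(same factors)·B` (`A_L = Δ = perLapT`,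
  `A_R = 1`; packages `B6Prop22LapMultiLevelTorus.prop22_sixth_multiLevelTorus` and `prop22_first_multiLevelTorus`).
* **`thm314_Gp_sup_flat_multiLevelTorus`** — all four sup entries ([4] (2.67)₁,₂,₃,₆; file 3's `G′` entry and the three above) with
  ONE set of constants `δ, C, M₀, N₀` (print's single «additional factor exp(−δ₀d(y, y′, Ω))»; `weaken_consts`).

## HONEST SCOPE

* `U = 1` only, the operator `G′` only, the SUP members only (with file 3: all four of [4] (2.67)₁,₂,₃,₆ = [B9] (3.42) + the p. 398 remark); not the Hölder or
  `L²` members, not the operators `G, G₁, 𝔊, H, H₁, (Q′G′²Q′*)⁻¹, (QGQ*)⁻¹`.  Torus lineage setting (`Ω₁ = T_η`, levels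
  `1 … k`, `A = 0`, `m² = 0`, lattice units `Lʲη ↦ L^j`, `P_μ ≥ 4`); (3.154) = file 1's `dOmega`; the characteristic factor
  carries `min(d_D, d_{D′})`.  A different (resolvent) proof of the printed statement on a model family, declared; nothing
  is inferred from the manuscript: every step is kernel-checked; the quoted sentences locate the statements.
-/

namespace Literature.MathematicalPhysics.QuantumFieldTheory.Balaban1983to89.B9Thm314GpFlatEntries

open Finset Matrix
open Literature.MathematicalPhysics.QuantumFieldTheory.Balaban1983to89.B4Reflection242 (boxDom mem_boxDom blk)
open Literature.MathematicalPhysics.QuantumFieldTheory.Balaban1983to89.B6MultiLevelBoxOperator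
open Literature.MathematicalPhysics.QuantumFieldTheory.Balaban1983to89.B6MultiLevelTorusOperator
open Literature.MathematicalPhysics.QuantumFieldTheory.Balaban1983to89.B6Geom246MultiLevelBox
open Literature.MathematicalPhysics.QuantumFieldTheory.Balaban1983to89.B6Geom246MultiLevelTorus
open Literature.MathematicalPhysics.QuantumFieldTheory.Balaban1983to89.B6Prop22MultiLevelTorus (prop22_first_multiLevelTorus)
open Literature.MathematicalPhysics.QuantumFieldTheory.Balaban1983to89.B6Prop22DerivMultiLevelTorus (dT
  prop22_second_multiLevelTorus)
open Literature.MathematicalPhysics.QuantumFieldTheory.Balaban1983to89.B6Prop22AdjMultiLevelTorus (prop22_third_multiLevelTorus)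
open Literature.MathematicalPhysics.QuantumFieldTheory.Balaban1983to89.B6Prop22LapMultiLevelTorus (prop22_sixth_multiLevelTorus)
open Literature.MathematicalPhysics.QuantumFieldTheory.Balaban1983to89.B6RandomWalk (HasMajorant BlockSupp)
open Literature.MathematicalPhysics.QuantumFieldTheory.Balaban1983to89.B6Ineq243TwoLevelBox (aNext)
open Literature.MathematicalPhysics.QuantumFieldTheory.Balaban1983to89.B9Thm314GpFlatTorusGeometry
open Literature.MathematicalPhysics.QuantumFieldTheory.Balaban1983to89.B9Thm314GpFlatMultiLevelTorus

noncomputable section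

variable {d : ℕ}

/-- **THEOREM 3.14 AT `U = 1`, ENTRY [B9] (3.42)₂ = [4] (2.67)₂ (`∇G′`)**: for two torus families and common top blocks,
`|((∇_μG′[D] − ∇_μG′[D′])λ)(x)| ≤ C·L^k·e^{−δ·min(d_D(y,y′),d_{D′}(y,y′))}·e^{−δ·d(y,y′,Ω)}·B`, constants `k`-uniform and
uniform in `μ`. [cite: Balaban1985BackgroundPropagators, Thm 3.14 (3.154) pp.426–427, (3.42) p.397; Balaban1984PropagatorsII, Prop. 2.2 (2.67) p.234 (second entry)] -/
theorem thm314_dGp_flat_multiLevelTorus (d ℓ : ℕ) (hℓ : 1 ≤ ℓ) (aminus aplus a2minus a2plus : ℝ) (ha : 0 < aminus)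
    (ha2 : 0 < a2minus) :
    ∃ δ C M₀ : ℝ, ∃ N₀ : ℕ, 0 < δ ∧ 0 < C ∧ 0 < M₀ ∧ 0 < N₀ ∧
      ∀ (k Mh R : ℕ), 3 ≤ Mh → M₀ ≤ ((ℓ : ℝ) + 1) * Mh → 2 * (ℓ + 1) ≤ R → N₀ + 1 ≤ R * ((ℓ + 1) * Mh) →
      ∀ (P : Fin (d + 1) → ℕ) (hP : ∀ μ, 1 ≤ P μ) (hP4 : ∀ μ, 4 ≤ P μ) (D D' : TDomains d ℓ Mh k P R)
        (a c : ℕ → ℝ), (∀ i, 1 ≤ i → aminus ≤ a i ∧ a i ≤ aplus) → (∀ i, 1 ≤ i → a2minus ≤ c i ∧ c i ≤ a2plus) →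
        (∀ i, 1 ≤ i → a (i + 1) = aNext ℓ (a i) (c i)) →
      ∀ (p q : ℕ × (Fin (d + 1) → ℤ)) (hpD : p ∈ bset D.toDomains) (hpD' : p ∈ bset D'.toDomains)
        (hqD : q ∈ bset D.toDomains) (hqD' : q ∈ bset D'.toDomains), p.1 = k → q.1 = k →
      ∀ (lam : ↥(boxDom (N0 ℓ Mh k P)) → ℝ) (B : ℝ),
        BlockSupp (g := geomT D) (blkOf D.toDomains) lam ⟨q, hqD⟩ B →
      ∀ x : ↥(boxDom (N0 ℓ Mh k P)), blkOf D.toDomains x = ⟨p, hpD⟩ → ∀ μ : Fin (d + 1),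
        |((dT (N0 ℓ Mh k P) μ * gmlT (N0 ℓ Mh k P) ℓ k D.lev a - dT (N0 ℓ Mh k P) μ * gmlT (N0 ℓ Mh k P) ℓ k D'.lev a)
            *ᵥ lam) x|
          ≤ C * ((ℓ : ℝ) + 1) ^ k
              * Real.exp (-(δ * min ((geomT D).dist ⟨p, hpD⟩ ⟨q, hqD⟩) ((geomT D').dist ⟨p, hpD'⟩ ⟨q, hqD'⟩)))
              * Real.exp (-(δ * dOmega D D' p.2 q.2)) * B := by
  obtain ⟨δ₀, C₀, M₀, N₀, hδ₀, hC₀, hM₀, -, hfirst⟩ := prop22_first_multiLevelTorus d ℓ hℓ aminus aplus a2minus a2plus ha ha2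
  obtain ⟨δ₂, C₂, M₂, N₂, hδ₂, hC₂, hM₂, -, hsecond⟩ :=
    prop22_second_multiLevelTorus d ℓ hℓ aminus aplus a2minus a2plus ha ha2
  -- the packages: composite = left factor = `∇_μG′` (exponent 1), inner factor = `G′` (exponent 2)
  have hT : MajFamily d ℓ aminus aplus a2minus a2plus (ι := Fin (d + 1)) (fun μ Mh k P => dT (N0 ℓ Mh k P) μ)
      (fun _ Mh k P => (1 : Matrix ↥(boxDom (N0 ℓ Mh k P)) ↥(boxDom (N0 ℓ Mh k P)) ℝ)) 1 (δ₂ / 2) C₂ M₂ N₂ := by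
    intro k Mh R hMh hM hR hRM P hP hP4 D a c haw hcw hac μ
    rw [Matrix.mul_one]
    exact hasMajorant_of_eq D (hsecond k Mh R hMh hM hR hRM P hP hP4 D a c haw hcw hac μ) fun y y' => by rw [one_mul]
  have hR : MajFamily d ℓ aminus aplus a2minus a2plus (ι := Fin (d + 1))
      (fun _ Mh k P => (1 : Matrix ↥(boxDom (N0 ℓ Mh k P)) ↥(boxDom (N0 ℓ Mh k P)) ℝ))
      (fun _ Mh k P => (1 : Matrix ↥(boxDom (N0 ℓ Mh k P)) ↥(boxDom (N0 ℓ Mh k P)) ℝ)) 2 (δ₀ / 2) C₀ M₀ N₀ := by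
    intro k Mh R hMh hM hR hRM P hP hP4 D a c haw hcw hac _
    rw [Matrix.one_mul, Matrix.mul_one]
    exact hfirst k Mh R hMh hM hR hRM P hP hP4 D a c haw hcw hac
  obtain ⟨δ, C, M₁, N₁, hδ, hC, hM₁, hN₁, h⟩ := thm314_flat_master d ℓ ha (ι := Fin (d + 1))
    (fun μ Mh k P => dT (N0 ℓ Mh k P) μ) (fun _ Mh k P => (1 : Matrix ↥(boxDom (N0 ℓ Mh k P)) ↥(boxDom (N0 ℓ Mh k P)) ℝ))
    (fun Mh k P => (1 : Matrix ↥(boxDom (N0 ℓ Mh k P)) ↥(boxDom (N0 ℓ Mh k P)) ℝ)) (fun _ _ _ => rfl)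
    (nT := 1) (nL := 1) (m := 2) rfl (half_pos hδ₂) hC₂ hM₂ (half_pos hδ₂) hC₂ (half_pos hδ₀) hC₀ hT hT hR
  refine ⟨δ, C, M₁, N₁, hδ, hC, hM₁, hN₁, ?_⟩
  intro k Mh R hMh hM hR hRM P hP hP4 D D' a c haw hcw hac p q hpD hpD' hqD hqD' hp hq lam B hlam x hx μ
  have h1 := h k Mh R hMh hM hR hRM P hP hP4 D D' a c haw hcw hac p q hpD hpD' hqD hqD' hp hq lam B hlam x hx μ
  rw [Matrix.mul_one, Matrix.mul_one, Nat.one_mul] at h1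
  exact h1

/-- **THEOREM 3.14 AT `U = 1`, ENTRY [4] (2.67)₃ (`G′∇*`; in [B9] by the p. 398 remark «we may always replace ∇_U by ∇*_U»)**: for two torus families and common top blocks,
`|((G′[D]∇_μ* − G′[D′]∇_μ*)λ)(x)| ≤ C·L^k·e^{−δ·min(d_D(y,y′),d_{D′}(y,y′))}·e^{−δ·d(y,y′,Ω)}·B`, constants `k`-uniform and
uniform in `μ`. [cite: Balaban1985BackgroundPropagators, Thm 3.14 (3.154) pp.426–427, (3.42) p.397 with the remark p.398; Balaban1984PropagatorsII, Prop. 2.2 (2.67) p.234 (third entry)] -/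
theorem thm314_Gpd_flat_multiLevelTorus (d ℓ : ℕ) (hℓ : 1 ≤ ℓ) (aminus aplus a2minus a2plus : ℝ) (ha : 0 < aminus)
    (ha2 : 0 < a2minus) :
    ∃ δ C M₀ : ℝ, ∃ N₀ : ℕ, 0 < δ ∧ 0 < C ∧ 0 < M₀ ∧ 0 < N₀ ∧
      ∀ (k Mh R : ℕ), 3 ≤ Mh → M₀ ≤ ((ℓ : ℝ) + 1) * Mh → 2 * (ℓ + 1) ≤ R → N₀ + 1 ≤ R * ((ℓ + 1) * Mh) →
      ∀ (P : Fin (d + 1) → ℕ) (hP : ∀ μ, 1 ≤ P μ) (hP4 : ∀ μ, 4 ≤ P μ) (D D' : TDomains d ℓ Mh k P R)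
        (a c : ℕ → ℝ), (∀ i, 1 ≤ i → aminus ≤ a i ∧ a i ≤ aplus) → (∀ i, 1 ≤ i → a2minus ≤ c i ∧ c i ≤ a2plus) →
        (∀ i, 1 ≤ i → a (i + 1) = aNext ℓ (a i) (c i)) →
      ∀ (p q : ℕ × (Fin (d + 1) → ℤ)) (hpD : p ∈ bset D.toDomains) (hpD' : p ∈ bset D'.toDomains)
        (hqD : q ∈ bset D.toDomains) (hqD' : q ∈ bset D'.toDomains), p.1 = k → q.1 = k →
      ∀ (lam : ↥(boxDom (N0 ℓ Mh k P)) → ℝ) (B : ℝ),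
        BlockSupp (g := geomT D) (blkOf D.toDomains) lam ⟨q, hqD⟩ B →
      ∀ x : ↥(boxDom (N0 ℓ Mh k P)), blkOf D.toDomains x = ⟨p, hpD⟩ → ∀ μ : Fin (d + 1),
        |((gmlT (N0 ℓ Mh k P) ℓ k D.lev a * (dT (N0 ℓ Mh k P) μ)ᵀ - gmlT (N0 ℓ Mh k P) ℓ k D'.lev a * (dT (N0 ℓ Mh k P) μ)ᵀ)
            *ᵥ lam) x|
          ≤ C * ((ℓ : ℝ) + 1) ^ k
              * Real.exp (-(δ * min ((geomT D).dist ⟨p, hpD⟩ ⟨q, hqD⟩) ((geomT D').dist ⟨p, hpD'⟩ ⟨q, hqD'⟩)))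
              * Real.exp (-(δ * dOmega D D' p.2 q.2)) * B := by
  obtain ⟨δ₀, C₀, M₀, N₀, hδ₀, hC₀, hM₀, -, hfirst⟩ := prop22_first_multiLevelTorus d ℓ hℓ aminus aplus a2minus a2plus ha ha2
  obtain ⟨δ₃, C₃, M₃, N₃, hδ₃, hC₃, hM₃, -, hthird⟩ := prop22_third_multiLevelTorus d ℓ hℓ aminus aplus a2minus a2plus ha ha2
  -- the packages: composite = inner factor = `G′∇_μ*` (exponent 1), left factor = `G′` (exponent 2)
  have hT : MajFamily d ℓ aminus aplus a2minus a2plus (ι := Fin (d + 1))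
      (fun _ Mh k P => (1 : Matrix ↥(boxDom (N0 ℓ Mh k P)) ↥(boxDom (N0 ℓ Mh k P)) ℝ))
      (fun μ Mh k P => (dT (N0 ℓ Mh k P) μ)ᵀ) 1 (δ₃ / 2) C₃ M₃ N₃ := by
    intro k Mh R hMh hM hR hRM P hP hP4 D a c haw hcw hac μ
    rw [Matrix.one_mul]
    exact hasMajorant_of_eq D (hthird k Mh R hMh hM hR hRM P hP hP4 D a c haw hcw hac μ) fun y y' => by rw [one_mul]
  have hL : MajFamily d ℓ aminus aplus a2minus a2plus (ι := Fin (d + 1))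
      (fun _ Mh k P => (1 : Matrix ↥(boxDom (N0 ℓ Mh k P)) ↥(boxDom (N0 ℓ Mh k P)) ℝ))
      (fun _ Mh k P => (1 : Matrix ↥(boxDom (N0 ℓ Mh k P)) ↥(boxDom (N0 ℓ Mh k P)) ℝ)) 2 (δ₀ / 2) C₀ M₀ N₀ := by
    intro k Mh R hMh hM hR hRM P hP hP4 D a c haw hcw hac _
    rw [Matrix.one_mul, Matrix.mul_one]
    exact hfirst k Mh R hMh hM hR hRM P hP hP4 D a c haw hcw hac
  obtain ⟨δ, C, M₁, N₁, hδ, hC, hM₁, hN₁, h⟩ := thm314_flat_master d ℓ ha (ι := Fin (d + 1))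
    (fun _ Mh k P => (1 : Matrix ↥(boxDom (N0 ℓ Mh k P)) ↥(boxDom (N0 ℓ Mh k P)) ℝ)) (fun μ Mh k P => (dT (N0 ℓ Mh k P) μ)ᵀ)
    (fun Mh k P => (1 : Matrix ↥(boxDom (N0 ℓ Mh k P)) ↥(boxDom (N0 ℓ Mh k P)) ℝ)) (fun _ _ _ => rfl)
    (nT := 1) (nL := 2) (m := 1) rfl (half_pos hδ₃) hC₃ hM₃ (half_pos hδ₀) hC₀ (half_pos hδ₃) hC₃ hT hL hT
  refine ⟨δ, C, M₁, N₁, hδ, hC, hM₁, hN₁, ?_⟩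
  intro k Mh R hMh hM hR hRM P hP hP4 D D' a c haw hcw hac p q hpD hpD' hqD hqD' hp hq lam B hlam x hx μ
  have h1 := h k Mh R hMh hM hR hRM P hP hP4 D D' a c haw hcw hac p q hpD hpD' hqD hqD' hp hq lam B hlam x hx μ
  rw [Matrix.one_mul, Matrix.one_mul, Nat.one_mul] at h1
  exact h1

/-- **THEOREM 3.14 AT `U = 1`, ENTRY [B9] (3.42)₃ = [4] (2.67)₆ (`ΔG′`)**: for two torus families and common top blocks,
`|((ΔG′[D] − ΔG′[D′])λ)(x)| ≤ C·e^{−δ·min(d_D(y,y′),d_{D′}(y,y′))}·e^{−δ·d(y,y′,Ω)}·B` (`Δ` = the periodic Laplacian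
`perLapT`), constants `k`-uniform. [cite: Balaban1985BackgroundPropagators, Thm 3.14 (3.154) pp.426–427, (3.42) p.397; Balaban1984PropagatorsII, Prop. 2.2 (2.67) p.234 (sixth entry)] -/
theorem thm314_lapGp_flat_multiLevelTorus (d ℓ : ℕ) (hℓ : 1 ≤ ℓ) (aminus aplus a2minus a2plus : ℝ) (ha : 0 < aminus)
    (ha2 : 0 < a2minus) :
    ∃ δ C M₀ : ℝ, ∃ N₀ : ℕ, 0 < δ ∧ 0 < C ∧ 0 < M₀ ∧ 0 < N₀ ∧
      ∀ (k Mh R : ℕ), 3 ≤ Mh → M₀ ≤ ((ℓ : ℝ) + 1) * Mh → 2 * (ℓ + 1) ≤ R → N₀ + 1 ≤ R * ((ℓ + 1) * Mh) →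
      ∀ (P : Fin (d + 1) → ℕ) (hP : ∀ μ, 1 ≤ P μ) (hP4 : ∀ μ, 4 ≤ P μ) (D D' : TDomains d ℓ Mh k P R)
        (a c : ℕ → ℝ), (∀ i, 1 ≤ i → aminus ≤ a i ∧ a i ≤ aplus) → (∀ i, 1 ≤ i → a2minus ≤ c i ∧ c i ≤ a2plus) →
        (∀ i, 1 ≤ i → a (i + 1) = aNext ℓ (a i) (c i)) →
      ∀ (p q : ℕ × (Fin (d + 1) → ℤ)) (hpD : p ∈ bset D.toDomains) (hpD' : p ∈ bset D'.toDomains)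
        (hqD : q ∈ bset D.toDomains) (hqD' : q ∈ bset D'.toDomains), p.1 = k → q.1 = k →
      ∀ (lam : ↥(boxDom (N0 ℓ Mh k P)) → ℝ) (B : ℝ),
        BlockSupp (g := geomT D) (blkOf D.toDomains) lam ⟨q, hqD⟩ B →
      ∀ x : ↥(boxDom (N0 ℓ Mh k P)), blkOf D.toDomains x = ⟨p, hpD⟩ →
        |((perLapT (N0 ℓ Mh k P) * gmlT (N0 ℓ Mh k P) ℓ k D.lev a - perLapT (N0 ℓ Mh k P) * gmlT (N0 ℓ Mh k P) ℓ k D'.lev a)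
            *ᵥ lam) x|
          ≤ C * Real.exp (-(δ * min ((geomT D).dist ⟨p, hpD⟩ ⟨q, hqD⟩) ((geomT D').dist ⟨p, hpD'⟩ ⟨q, hqD'⟩)))
              * Real.exp (-(δ * dOmega D D' p.2 q.2)) * B := by
  obtain ⟨δ₀, C₀, M₀, N₀, hδ₀, hC₀, hM₀, -, hfirst⟩ := prop22_first_multiLevelTorus d ℓ hℓ aminus aplus a2minus a2plus ha ha2
  obtain ⟨δ₆, C₆, M₆, N₆, hδ₆, hC₆, hM₆, -, hsixth⟩ := prop22_sixth_multiLevelTorus d ℓ hℓ aminus aplus a2minus a2plus ha ha2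
  -- the packages: composite = left factor = `ΔG′` (exponent 0), inner factor = `G′` (exponent 2)
  have hT : MajFamily d ℓ aminus aplus a2minus a2plus (ι := Unit) (fun _ Mh k P => perLapT (N0 ℓ Mh k P))
      (fun _ Mh k P => (1 : Matrix ↥(boxDom (N0 ℓ Mh k P)) ↥(boxDom (N0 ℓ Mh k P)) ℝ)) 0 (δ₆ / 2) C₆ M₆ N₆ := by
    intro k Mh R hMh hM hR hRM P hP hP4 D a c haw hcw hac _
    rw [Matrix.mul_one]
    exact hasMajorant_of_eq D (hsixth k Mh R hMh hM hR hRM P hP hP4 D a c haw hcw hac) fun y y' => by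
      rw [Nat.zero_mul, pow_zero, mul_one]
  have hR : MajFamily d ℓ aminus aplus a2minus a2plus (ι := Unit)
      (fun _ Mh k P => (1 : Matrix ↥(boxDom (N0 ℓ Mh k P)) ↥(boxDom (N0 ℓ Mh k P)) ℝ))
      (fun _ Mh k P => (1 : Matrix ↥(boxDom (N0 ℓ Mh k P)) ↥(boxDom (N0 ℓ Mh k P)) ℝ)) 2 (δ₀ / 2) C₀ M₀ N₀ := by
    intro k Mh R hMh hM hR hRM P hP hP4 D a c haw hcw hac _
    rw [Matrix.one_mul, Matrix.mul_one]
    exact hfirst k Mh R hMh hM hR hRM P hP hP4 D a c haw hcw hac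
  obtain ⟨δ, C, M₁, N₁, hδ, hC, hM₁, hN₁, h⟩ := thm314_flat_master d ℓ ha (ι := Unit)
    (fun _ Mh k P => perLapT (N0 ℓ Mh k P)) (fun _ Mh k P => (1 : Matrix ↥(boxDom (N0 ℓ Mh k P)) ↥(boxDom (N0 ℓ Mh k P)) ℝ))
    (fun Mh k P => (1 : Matrix ↥(boxDom (N0 ℓ Mh k P)) ↥(boxDom (N0 ℓ Mh k P)) ℝ)) (fun _ _ _ => rfl)
    (nT := 0) (nL := 0) (m := 2) rfl (half_pos hδ₆) hC₆ hM₆ (half_pos hδ₆) hC₆ (half_pos hδ₀) hC₀ hT hT hR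
  refine ⟨δ, C, M₁, N₁, hδ, hC, hM₁, hN₁, ?_⟩
  intro k Mh R hMh hM hR hRM P hP hP4 D D' a c haw hcw hac p q hpD hpD' hqD hqD' hp hq lam B hlam x hx
  have h1 := h k Mh R hMh hM hR hRM P hP hP4 D D' a c haw hcw hac p q hpD hpD' hqD hqD' hp hq lam B hlam x hx ()
  rw [Matrix.mul_one, Matrix.mul_one, Nat.zero_mul, pow_zero, mul_one] at h1
  exact h1

/-- weakening a bound of the shape `Cᵢ·W·e^{−δᵢm}·e^{−δᵢd_Ω}·B` to common constants `δ ≤ δᵢ`, `C ≥ Cᵢ ≥ 0`.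
[cite: Balaban1985BackgroundPropagators, Thm 3.14 p.427 («after adjusting a definition of δ₀»), dictionary] -/
theorem weaken_consts {X Ci C W δi δ m dΩ B : ℝ} (hδ : δ ≤ δi) (hCi : 0 ≤ Ci) (hC : Ci ≤ C) (hW : 0 ≤ W) (hm : 0 ≤ m)
    (hΩ : 0 ≤ dΩ) (hB : 0 ≤ B) (h : X ≤ Ci * W * Real.exp (-(δi * m)) * Real.exp (-(δi * dΩ)) * B) :
    X ≤ C * W * Real.exp (-(δ * m)) * Real.exp (-(δ * dΩ)) * B := by
  have h1 : Real.exp (-(δi * m)) ≤ Real.exp (-(δ * m)) := Real.exp_le_exp.2 (by nlinarith)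
  have h2 : Real.exp (-(δi * dΩ)) ≤ Real.exp (-(δ * dΩ)) := Real.exp_le_exp.2 (by nlinarith)
  refine h.trans ?_
  have h12 := mul_le_mul h1 h2 (Real.exp_pos _).le (Real.exp_pos _).le
  calc Ci * W * Real.exp (-(δi * m)) * Real.exp (-(δi * dΩ)) * B
      = Ci * W * (Real.exp (-(δi * m)) * Real.exp (-(δi * dΩ))) * B := by ring
    _ ≤ C * W * (Real.exp (-(δ * m)) * Real.exp (-(δ * dΩ))) * B :=
        mul_le_mul_of_nonneg_right (mul_le_mul (mul_le_mul_of_nonneg_right hC hW) h12 (by positivity)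
          (mul_nonneg (hCi.trans hC) hW)) hB
    _ = _ := by ring

/-- **THEOREM 3.14 AT `U = 1` FOR `G′`: ALL FOUR SUP ENTRIES ([4] (2.67)₁,₂,₃,₆ = [B9] (3.42) + p. 398) WITH ONE SET OF CONSTANTS** — there are
`δ, C, M₀ > 0`, `N₀ ≥ 1` (`k`-uniform, uniform in `μ`, independent of the two families) such that, for all admissible data
as in file 3 and common top blocks `y ∋ x`, `y′ ⊃ supp λ` (`|λ| ≤ B`), with `E := e^{−δ·min(d_D,d_{D′})(y,y′)}·e^{−δ·d(y,y′,Ω)}`: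
`|((G′[D] − G′[D′])λ)(x)| ≤ C·L^{2k}·E·B`, `|((∇_μG′[D] − ∇_μG′[D′])λ)(x)| ≤ C·L^k·E·B`,
`|((G′[D]∇_μ* − G′[D′]∇_μ*)λ)(x)| ≤ C·L^k·E·B`, `|((ΔG′[D] − ΔG′[D′])λ)(x)| ≤ C·E·B` («their difference satisfies all
the inequalities characteristic for operators of the considered type, with the additional factor exp(−δ₀d(y, y′, Ω))» —
here: the sup members of (3.42) for `G′`, with the p. 398 remark). [cite: Balaban1985BackgroundPropagators, Thm 3.14 (3.154) pp.426–427, (3.42) p.397, p.398; Balaban1984PropagatorsII, Prop. 2.2 (2.67) p.234] -/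
theorem thm314_Gp_sup_flat_multiLevelTorus (d ℓ : ℕ) (hℓ : 1 ≤ ℓ) (aminus aplus a2minus a2plus : ℝ) (ha : 0 < aminus)
    (ha2 : 0 < a2minus) :
    ∃ δ C M₀ : ℝ, ∃ N₀ : ℕ, 0 < δ ∧ 0 < C ∧ 0 < M₀ ∧ 0 < N₀ ∧
      ∀ (k Mh R : ℕ), 3 ≤ Mh → M₀ ≤ ((ℓ : ℝ) + 1) * Mh → 2 * (ℓ + 1) ≤ R → N₀ + 1 ≤ R * ((ℓ + 1) * Mh) →
      ∀ (P : Fin (d + 1) → ℕ) (hP : ∀ μ, 1 ≤ P μ) (hP4 : ∀ μ, 4 ≤ P μ) (D D' : TDomains d ℓ Mh k P R)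
        (a c : ℕ → ℝ), (∀ i, 1 ≤ i → aminus ≤ a i ∧ a i ≤ aplus) → (∀ i, 1 ≤ i → a2minus ≤ c i ∧ c i ≤ a2plus) →
        (∀ i, 1 ≤ i → a (i + 1) = aNext ℓ (a i) (c i)) →
      ∀ (p q : ℕ × (Fin (d + 1) → ℤ)) (hpD : p ∈ bset D.toDomains) (hpD' : p ∈ bset D'.toDomains)
        (hqD : q ∈ bset D.toDomains) (hqD' : q ∈ bset D'.toDomains), p.1 = k → q.1 = k →
      ∀ (lam : ↥(boxDom (N0 ℓ Mh k P)) → ℝ) (B : ℝ),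
        BlockSupp (g := geomT D) (blkOf D.toDomains) lam ⟨q, hqD⟩ B →
      ∀ x : ↥(boxDom (N0 ℓ Mh k P)), blkOf D.toDomains x = ⟨p, hpD⟩ →
        |((gmlT (N0 ℓ Mh k P) ℓ k D.lev a - gmlT (N0 ℓ Mh k P) ℓ k D'.lev a) *ᵥ lam) x|
            ≤ C * ((ℓ : ℝ) + 1) ^ (2 * k)
              * Real.exp (-(δ * min ((geomT D).dist ⟨p, hpD⟩ ⟨q, hqD⟩) ((geomT D').dist ⟨p, hpD'⟩ ⟨q, hqD'⟩)))
              * Real.exp (-(δ * dOmega D D' p.2 q.2)) * B ∧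
        (∀ μ : Fin (d + 1),
          |((dT (N0 ℓ Mh k P) μ * gmlT (N0 ℓ Mh k P) ℓ k D.lev a - dT (N0 ℓ Mh k P) μ * gmlT (N0 ℓ Mh k P) ℓ k D'.lev a)
              *ᵥ lam) x|
            ≤ C * ((ℓ : ℝ) + 1) ^ k
              * Real.exp (-(δ * min ((geomT D).dist ⟨p, hpD⟩ ⟨q, hqD⟩) ((geomT D').dist ⟨p, hpD'⟩ ⟨q, hqD'⟩)))
              * Real.exp (-(δ * dOmega D D' p.2 q.2)) * B) ∧
        (∀ μ : Fin (d + 1),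
          |((gmlT (N0 ℓ Mh k P) ℓ k D.lev a * (dT (N0 ℓ Mh k P) μ)ᵀ
              - gmlT (N0 ℓ Mh k P) ℓ k D'.lev a * (dT (N0 ℓ Mh k P) μ)ᵀ) *ᵥ lam) x|
            ≤ C * ((ℓ : ℝ) + 1) ^ k
              * Real.exp (-(δ * min ((geomT D).dist ⟨p, hpD⟩ ⟨q, hqD⟩) ((geomT D').dist ⟨p, hpD'⟩ ⟨q, hqD'⟩)))
              * Real.exp (-(δ * dOmega D D' p.2 q.2)) * B) ∧
        |((perLapT (N0 ℓ Mh k P) * gmlT (N0 ℓ Mh k P) ℓ k D.lev a - perLapT (N0 ℓ Mh k P) * gmlT (N0 ℓ Mh k P) ℓ k D'.lev a)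
            *ᵥ lam) x|
            ≤ C * Real.exp (-(δ * min ((geomT D).dist ⟨p, hpD⟩ ⟨q, hqD⟩) ((geomT D').dist ⟨p, hpD'⟩ ⟨q, hqD'⟩)))
              * Real.exp (-(δ * dOmega D D' p.2 q.2)) * B := by
  obtain ⟨δ₁, C₁, M₁, N₁, hδ₁, hC₁, hM₁, hN₁, h₁⟩ := thm314_Gp_flat_multiLevelTorus d ℓ hℓ aminus aplus a2minus a2plus ha ha2
  obtain ⟨δ₂, C₂, M₂, N₂, hδ₂, hC₂, hM₂, -, h₂⟩ := thm314_dGp_flat_multiLevelTorus d ℓ hℓ aminus aplus a2minus a2plus ha ha2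
  obtain ⟨δ₃, C₃, M₃, N₃, hδ₃, hC₃, hM₃, -, h₃⟩ := thm314_Gpd_flat_multiLevelTorus d ℓ hℓ aminus aplus a2minus a2plus ha ha2
  obtain ⟨δ₄, C₄, M₄, N₄, hδ₄, hC₄, hM₄, -, h₄⟩ := thm314_lapGp_flat_multiLevelTorus d ℓ hℓ aminus aplus a2minus a2plus ha ha2
  refine ⟨min (min δ₁ δ₂) (min δ₃ δ₄), max (max C₁ C₂) (max C₃ C₄), max (max M₁ M₂) (max M₃ M₄),
    max (max N₁ N₂) (max N₃ N₄), lt_min (lt_min hδ₁ hδ₂) (lt_min hδ₃ hδ₄),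
    lt_of_lt_of_le hC₁ ((le_max_left _ _).trans (le_max_left _ _)),
    lt_of_lt_of_le hM₁ ((le_max_left _ _).trans (le_max_left _ _)),
    lt_of_lt_of_le hN₁ ((le_max_left _ _).trans (le_max_left _ _)), ?_⟩
  intro k Mh R hMh hM hR hRM P hP hP4 D D' a c haw hcw hac p q hpD hpD' hqD hqD' hp hq lam B hlam x hx
  have hMh1 : 1 ≤ Mh := le_trans (by norm_num) hMh
  have hL0 : (0 : ℝ) < (ℓ : ℝ) + 1 := by positivity
  have hB : 0 ≤ B := hlam.nonneg
  have hm0 : 0 ≤ min ((geomT D).dist ⟨p, hpD⟩ ⟨q, hqD⟩) ((geomT D').dist ⟨p, hpD'⟩ ⟨q, hqD'⟩) :=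
    le_min ((triangle_refl_nonneg_T D hMh1 hP).2.2 _ _) ((triangle_refl_nonneg_T D' hMh1 hP).2.2 _ _)
  have hΩ0 : 0 ≤ dOmega D D' p.2 q.2 := dOmega_nonneg D D' p.2 q.2
  -- thresholds of each entry from the common ones
  have hM1 : M₁ ≤ ((ℓ : ℝ) + 1) * Mh := le_trans ((le_max_left _ _).trans (le_max_left _ _)) hM
  have hM2 : M₂ ≤ ((ℓ : ℝ) + 1) * Mh := le_trans ((le_max_right _ _).trans (le_max_left _ _)) hM
  have hM3 : M₃ ≤ ((ℓ : ℝ) + 1) * Mh := le_trans ((le_max_left _ _).trans (le_max_right _ _)) hM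
  have hM4 : M₄ ≤ ((ℓ : ℝ) + 1) * Mh := le_trans ((le_max_right _ _).trans (le_max_right _ _)) hM
  have hN1' : N₁ + 1 ≤ R * ((ℓ + 1) * Mh) :=
    le_trans (Nat.add_le_add_right ((le_max_left _ _).trans (le_max_left _ _)) 1) hRM
  have hN2' : N₂ + 1 ≤ R * ((ℓ + 1) * Mh) :=
    le_trans (Nat.add_le_add_right ((le_max_right _ _).trans (le_max_left _ _)) 1) hRM
  have hN3' : N₃ + 1 ≤ R * ((ℓ + 1) * Mh) :=
    le_trans (Nat.add_le_add_right ((le_max_left _ _).trans (le_max_right _ _)) 1) hRM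
  have hN4' : N₄ + 1 ≤ R * ((ℓ + 1) * Mh) :=
    le_trans (Nat.add_le_add_right ((le_max_right _ _).trans (le_max_right _ _)) 1) hRM
  have hd1 : min (min δ₁ δ₂) (min δ₃ δ₄) ≤ δ₁ := (min_le_left _ _).trans (min_le_left _ _)
  have hd2 : min (min δ₁ δ₂) (min δ₃ δ₄) ≤ δ₂ := (min_le_left _ _).trans (min_le_right _ _)
  have hd3 : min (min δ₁ δ₂) (min δ₃ δ₄) ≤ δ₃ := (min_le_right _ _).trans (min_le_left _ _)
  have hd4 : min (min δ₁ δ₂) (min δ₃ δ₄) ≤ δ₄ := (min_le_right _ _).trans (min_le_right _ _)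
  have hc1 : C₁ ≤ max (max C₁ C₂) (max C₃ C₄) := (le_max_left _ _).trans (le_max_left _ _)
  have hc2 : C₂ ≤ max (max C₁ C₂) (max C₃ C₄) := (le_max_right _ _).trans (le_max_left _ _)
  have hc3 : C₃ ≤ max (max C₁ C₂) (max C₃ C₄) := (le_max_left _ _).trans (le_max_right _ _)
  have hc4 : C₄ ≤ max (max C₁ C₂) (max C₃ C₄) := (le_max_right _ _).trans (le_max_right _ _)
  refine ⟨?_, fun μ => ?_, fun μ => ?_, ?_⟩
  · exact weaken_consts hd1 hC₁.le hc1 (by positivity) hm0 hΩ0 hB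
      (h₁ k Mh R hMh hM1 hR hN1' P hP hP4 D D' a c haw hcw hac p q hpD hpD' hqD hqD' hp hq lam B hlam x hx)
  · exact weaken_consts hd2 hC₂.le hc2 (by positivity) hm0 hΩ0 hB
      (h₂ k Mh R hMh hM2 hR hN2' P hP hP4 D D' a c haw hcw hac p q hpD hpD' hqD hqD' hp hq lam B hlam x hx μ)
  · exact weaken_consts hd3 hC₃.le hc3 (by positivity) hm0 hΩ0 hB
      (h₃ k Mh R hMh hM3 hR hN3' P hP hP4 D D' a c haw hcw hac p q hpD hpD' hqD hqD' hp hq lam B hlam x hx μ)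
  · have h := h₄ k Mh R hMh hM4 hR hN4' P hP hP4 D D' a c haw hcw hac p q hpD hpD' hqD hqD' hp hq lam B hlam x hx
    rw [← mul_one C₄] at h
    rw [← mul_one (max (max C₁ C₂) (max C₃ C₄))]
    exact weaken_consts hd4 hC₄.le hc4 zero_le_one hm0 hΩ0 hB h

end

end Literature.MathematicalPhysics.QuantumFieldTheory.Balaban1983to89.B9Thm314GpFlatEntries
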